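import Literature.NumberTheory.PAdicHodge.DeRhamInduceLocal
import Literature.NumberTheory.PAdicHodge.DeRhamBaseChangeProofs
import Literature.NumberTheory.PAdicHodge.CyclotomicDeRhamClause
import Literature.NumberTheory.PAdicHodge.FontaineDpstUnconditional
import Literature.NumberTheory.GaloisRepresentations.PotentialDiagonalizabilityCriteriaProofs
import HarnessLib

/-!
# De Rham descent and ascent along a finite extension of `p`-adic fields, for `ℚ_p`-linear Galois
# representations on a module (Brinon–Conrad 2009, Prop. 6.3.8) — module dialect of `DeRhamDescent_holds`

Topic `NumberTheory/PAdicHodge`; theorems only (no definition, no named fact, no instance).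

The tree proves Brinon–Conrad's Prop. 6.3.8 ("`V` is de Rham as a `G_K`-representation iff it is de Rham as a
`G_{K'}`-representation", `K'/K` finite) in two dialects: ASCENT at module level
(`isAdmissible_bdR_restrictField`: `V : GaloisRep K ℚ_ℓ M`), DESCENT for framed `Γ_K →ₜ* GL_n(ℚ̄_ℓ)` and THE pinned
datum (`DeRhamDescent_holds`, from the local induction theorem `isAdmissible_bdR_induce` and the Frobenius
counit `isAdmissible_restrictScalars_of_induce_comp`). This file records BOTH directions in the dialect of the
BSD-side facts (`GaloisRep.IsDeRham (bdRPeriodRingData hp) ρ` for `ρ : GaloisRep K ℚ_p M` on a finite-dimensional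
`ℚ_p`-vector space with its module topology, ANY `ℚ_p`-algebra structures on `K`, `L` — they are the canonical
ones, `algebraMap_padic_eq_padicRingHom`):

* `isDeRham_restrictField_of_isDeRham` — ascent `K ⇒ L`;
* `isDeRham_of_isDeRham_restrictField` — **descent `L ⇒ K`**: frame `ρ` (`exists_framedRep_holds`), move the
  frame to `ℚ_p = ⊥ ⊆ ℚ̄_p` (`FramedRep.baseChange` along `algebraMap ℚ_p ⊥`), induce the restriction to `Γ_L`
  (`isAdmissible_bdR_induce`), take the Frobenius counit (`isAdmissible_restrictScalars_of_induce_comp`), and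
  transport along the `ℚ_p`-linear equivariant isomorphisms (`isAdmissible_iff_of_equiv`);
* `isDeRham_iff_isDeRham_restrictField`.

Motivation (BSD cell `bsd-wall`, crux K★ `stmt-BirchSwinnertonDyer-22226`, stub hDR
`isDeRham_restrictedRationalTateRep`): an elliptic curve acquires semistable reduction over a finite `L/K`;
the sector theorems (`isDeRham_of_ordinary`, `isDeRham_of_cyclotomic_sub_of_trivial_quotient`) apply over `L`,
and this file brings de Rham-ness back to `K`.

## References

* [BrinonConrad2009] O. Brinon, B. Conrad, *CMI Summer School notes on p-adic Hodge theory* (2009), Prop. 6.3.8.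
* [Patrikis2019] S. Patrikis, *Variations on a theorem of Tate*, Mem. AMS 258 (2019), Lemma 7.2.1.
* [FontaineAsterisque223III] J.-M. Fontaine, Astérisque 223 (1994), Exp. III §1.5, Prop. 1.5.2.
-/

noncomputable section

open scoped MatrixGroups
open Field ValuativeRel

namespace Literature.NumberTheory.PAdicHodge

open Literature.NumberTheory.GaloisRepresentations
open Literature.NumberTheory.GaloisRepresentations.IsNonarchimedeanLocalField

variable {K L : Type} [Field K] [ValuativeRel K] [TopologicalSpace K] [IsNonarchimedeanLocalField K]
  [CharZero K] [Field L] [ValuativeRel L] [TopologicalSpace L] [IsNonarchimedeanLocalField L]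
  [CharZero L] [Algebra K L] {p : ℕ} [Fact p.Prime]
  [Fact (¬ IsUnit ((p : ℕ) : integerC K))] [IsAdicComplete (Ideal.span {((p : ℕ) : integerC K)}) (integerC K)]
  [Fact (¬ IsUnit ((p : ℕ) : integerC L))] [IsAdicComplete (Ideal.span {((p : ℕ) : integerC L)}) (integerC L)]
  [Algebra ℚ_[p] K] [Algebra ℚ_[p] L]
  {M : Type} [AddCommGroup M] [Module ℚ_[p] M] [TopologicalSpace M]

/-- **Ascent** (Brinon–Conrad 2009, Prop. 6.3.8, for any `ℚ_p`-algebra structures): if `ρ` is de Rham for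
`B_dR(K)` then `ρ|_{Γ_L}` is de Rham for `B_dR(L)` — the module-level `isAdmissible_bdR_restrictField` of the
tree with the canonical-structure pins discharged by `algebraMap_padic_eq_padicRingHom`.
[cite: BrinonConrad2009, Prop. 6.3.8] [cite: FontaineAsterisque223III, Exp. III Thm. 1.5.2] -/
theorem isDeRham_restrictField_of_isDeRham (hcont : Continuous (algebraMap K L))
    (hK : valuation K (p : K) < 1) (hL : valuation L (p : L) < 1) [FiniteDimensional ℚ_[p] M]
    (ρ : GaloisRep K ℚ_[p] M) (h : GaloisRep.IsDeRham (bdRPeriodRingData (F := K) (p := p) hK) ρ) :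
    GaloisRep.IsDeRham (bdRPeriodRingData (F := L) (p := p) hL) (ρ.restrictField L) :=
  isAdmissible_bdR_restrictField (ℓ := p) hcont hK hL ‹Algebra ℚ_[p] K› (bdRPeriodRingData (F := K) (p := p) hK)
    (LocalField.algebra_padic_ext _ _) rfl ‹Algebra ℚ_[p] L› (bdRPeriodRingData (F := L) (p := p) hL)
    (LocalField.algebra_padic_ext _ _) rfl ρ h

variable [Module.Finite ℚ_[p] M] [IsModuleTopology ℚ_[p] M]

/-- **Descent** (Brinon–Conrad 2009, Prop. 6.3.8, converse half, for any `ℚ_p`-algebra structures): if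
`ρ|_{Γ_L}` is de Rham for `B_dR(L)` (`K → L` a continuous embedding of `p`-adic fields, so `L/K` finite), then
`ρ` is de Rham for `B_dR(K)`. Proof: frame `ρ` over `ℚ_p = ⊥ ⊆ ℚ̄_p`, induce `ρ|_{Γ_L}` to `Γ_K` (de Rham by the
local induction theorem `isAdmissible_bdR_induce`), and `ρ` is a quotient of the induction (Frobenius counit,
`isAdmissible_restrictScalars_of_induce_comp`). [cite: BrinonConrad2009, Prop. 6.3.8] [cite: Patrikis2019, Lemma 7.2.1] -/
theorem isDeRham_of_isDeRham_restrictField (hcont : Continuous (algebraMap K L))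
    (hK : valuation K (p : K) < 1) (hL : valuation L (p : L) < 1)
    (ρ : GaloisRep K ℚ_[p] M)
    (h : GaloisRep.IsDeRham (bdRPeriodRingData (F := L) (p := p) hL) (ρ.restrictField L)) :
    GaloisRep.IsDeRham (bdRPeriodRingData (F := K) (p := p) hK) ρ := by
  classical
  haveI : FiniteDimensional K L := finiteDimensional_of_continuous_algebraMap hcont hK hL
  haveI : Module.Free ℚ_[p] M := Module.Free.of_divisionRing ℚ_[p] M
  set 𝔅K := bdRPeriodRingData (F := K) (p := p) hK with h𝔅K
  set 𝔅L := bdRPeriodRingData (F := L) (p := p) hL with h𝔅L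
  -- a frame of `ρ` over `ℚ_p`, moved to `E₀ = ⊥ ⊆ ℚ̄_p`
  obtain ⟨n, ρ', ⟨eqv⟩⟩ :=
    ContinuousRep.exists_framedRep_holds (G := absoluteGaloisGroup K) (A := ℚ_[p]) (M := M) ρ
  set E₀ : IntermediateField ℚ_[p] (PadicAlgCl p) := ⊥ with hE₀
  set rK : FramedRep (absoluteGaloisGroup K) E₀ n :=
    ρ'.baseChange (algebraMap ℚ_[p] E₀) (continuous_algebraMap_bot p) with hrK
  -- the equivariant `ℚ_p`-linear isomorphism `M ≃ (Fin n → E₀)`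
  let e₀ : ℚ_[p] ≃ₗ[ℚ_[p]] E₀ := (IntermediateField.botEquiv ℚ_[p] (PadicAlgCl p)).symm.toLinearEquiv
  have he₀ : ∀ c : ℚ_[p], e₀ c = algebraMap ℚ_[p] E₀ c := fun c => IntermediateField.botEquiv_symm c
  let eF : (Fin n → ℚ_[p]) ≃ₗ[ℚ_[p]] (Fin n → E₀) := LinearEquiv.piCongrRight fun _ => e₀
  have heF : ∀ (σ : absoluteGaloisGroup K) (x : Fin n → ℚ_[p]),
      eF (ρ'.toContinuousRep σ x) = FramedRep.restrictScalars ℚ_[p] rK σ (eF x) := by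
    intro σ x
    ext i
    simp only [eF, LinearEquiv.piCongrRight_apply, FramedRep.toContinuousRep_apply_apply,
      FramedRep.restrictScalars_apply_apply, hrK, FramedRep.baseChange_apply,
      Matrix.GeneralLinearGroup.map_apply, Matrix.mulVec, dotProduct, he₀, map_sum, map_mul]
  let eM : M ≃ₗ[ℚ_[p]] (Fin n → E₀) := eqv.toLinearEquiv.symm.trans eF
  have heM : ∀ (σ : absoluteGaloisGroup K) (m : M), eM (ρ σ m) = FramedRep.restrictScalars ℚ_[p] rK σ (eM m) := by
    intro σ m
    change eF (eqv.toLinearEquiv.symm (ρ σ m)) = FramedRep.restrictScalars ℚ_[p] rK σ (eF (eqv.toLinearEquiv.symm m))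
    have h1 : eqv.toLinearEquiv.symm (ρ σ m) = ρ'.toContinuousRep σ (eqv.toLinearEquiv.symm m) := by
      apply eqv.toLinearEquiv.injective
      rw [LinearEquiv.apply_symm_apply, eqv.apply_apply, LinearEquiv.apply_symm_apply]
    rw [h1, heF]
  -- over `L`: the restriction of the frame is admissible
  have hadmL : 𝔅L.IsAdmissible (FramedRep.restrictScalars ℚ_[p] (rK.comp (absGaloisRestrict K L))) := by
    refine (𝔅L.isAdmissible_iff_of_equiv (ρ.restrictField L)
      (FramedRep.restrictScalars ℚ_[p] (rK.comp (absGaloisRestrict K L))) eM fun σ m => ?_).1 h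
    exact heM (absGaloisRestrict K L σ) m
  -- coset representatives and the induction
  set t := absGaloisCosetRep K L rfl with ht_def
  have ht : Function.Bijective fun i =>
      (t i : absoluteGaloisGroup K ⧸ (absGaloisRestrict K L).toMonoidHom.range) :=
    absGaloisCosetRep_bijective K L rfl
  have hInd := isAdmissible_bdR_induce (ℓ := p) hcont hK hL ‹Algebra ℚ_[p] K› 𝔅K
    (LocalField.algebra_padic_ext _ _) h𝔅K ‹Algebra ℚ_[p] L› 𝔅L (LocalField.algebra_padic_ext _ _) h𝔅L ht
    (finProdFinEquiv : Fin (Module.finrank K L) × Fin n ≃ Fin (Module.finrank K L * n))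
    (rK.comp (absGaloisRestrict K L)) hadmL
  -- Frobenius counit: `ρ' ⊗ ⊥` is a quotient of the induction
  have hadmK : 𝔅K.IsAdmissible (FramedRep.restrictScalars ℚ_[p] rK) :=
    𝔅K.isAdmissible_restrictScalars_of_induce_comp (absGaloisRestrict K L)
      (isOpenEmbedding_absGaloisRestrict K L) ht finProdFinEquiv rK hInd
  exact (𝔅K.isAdmissible_iff_of_equiv ρ (FramedRep.restrictScalars ℚ_[p] rK) eM heM).2 hadmK

/-- **Brinon–Conrad 2009, Prop. 6.3.8, module dialect**: `ρ` is de Rham for `B_dR(K)` iff `ρ|_{Γ_L}` is de Rham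
for `B_dR(L)`. [cite: BrinonConrad2009, Prop. 6.3.8] -/
theorem isDeRham_iff_isDeRham_restrictField (hcont : Continuous (algebraMap K L))
    (hK : valuation K (p : K) < 1) (hL : valuation L (p : L) < 1) (ρ : GaloisRep K ℚ_[p] M) :
    GaloisRep.IsDeRham (bdRPeriodRingData (F := K) (p := p) hK) ρ ↔
      GaloisRep.IsDeRham (bdRPeriodRingData (F := L) (p := p) hL) (ρ.restrictField L) :=
  ⟨isDeRham_restrictField_of_isDeRham hcont hK hL ρ, isDeRham_of_isDeRham_restrictField hcont hK hL ρ⟩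

end Literature.NumberTheory.PAdicHodge

end
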